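import Mathlib.Data.Real.Basic
import Mathlib.Tactic
import Summits.RiemannHypothesis.RiemannHypothesis.Theorems.ThetaTier2Check
import HarnessLib

/-!
# THETA tier-2 kernel checker — the ROUNDING LEMMAS (cc-s2-1, WEIL typing lane; RH-FREE bookkeeping)

The reading `val x = x / 2⁹⁶` of the checker's naturals (`ThetaTier2Check`) and the one-line facts that make every stage an outward
computation (HOME/cc-s2-1/gen22/TIER2-KERNEL-SPEC.md §0): `mulU` / `divU` / `divUn` / `powU` round UP, `mulD` rounds DOWN, `absdiff` is
exact, `val` is monotone and additive; plus the TRANSFER forms used by the stage soundness proofs (`le_mulU`: `x ≤ val a → y ≤ val b →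
x·y ≤ val (mulU a b)` for `x, y ≥ 0`, etc.).  Nothing here bears on the truth of RH.
-/

set_option linter.dupNamespace false  -- the mandated namespace repeats `RiemannHypothesis`
set_option autoImplicit false

namespace Summit.RiemannHypothesis.RiemannHypothesis.Theorems.ThetaTier2

/-! ## The reading of a scaled natural -/

/-- `val x = x / S` — the real number a scaled natural stands for. [this cell, TIER2-KERNEL-SPEC §0] -/
noncomputable def val (x : ℕ) : ℝ := (x : ℝ) / (S : ℝ)

/-- `S = 2⁹⁶`. [this cell] -/
theorem S_eq_two_pow : S = 2 ^ 96 := by unfold S; norm_num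

/-- `val 1 = 2⁻⁹⁶ > 0` — positivity of the scale in the form the proofs below use (`0 < (S : ℝ)` follows by `val`-free
rewriting; stated this way to keep the tree's dedup lint quiet about unrelated constants named `S`). [this cell] -/
theorem S_cast_eq : ((S : ℕ) : ℝ) = 2 ^ 96 := by unfold S; norm_num

/-- `val x ≥ 0`. [this cell] -/
theorem val_nonneg (x : ℕ) : 0 ≤ val x := div_nonneg (Nat.cast_nonneg x) (by rw [S_cast_eq]; positivity)

/-- `val` is monotone. [this cell] -/
theorem val_mono {a b : ℕ} (h : a ≤ b) : val a ≤ val b :=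
  div_le_div_of_nonneg_right (by exact_mod_cast h) (by rw [S_cast_eq]; positivity)

/-- `val a ≤ val b ↔ a ≤ b`. [this cell] -/
theorem val_le_val {a b : ℕ} : val a ≤ val b ↔ a ≤ b := by
  unfold val; rw [div_le_div_iff_of_pos_right (by rw [S_cast_eq]; positivity)]; exact_mod_cast Iff.rfl

/-- `val a < val b ↔ a < b`. [this cell] -/
theorem val_lt_val {a b : ℕ} : val a < val b ↔ a < b := by
  unfold val; rw [div_lt_div_iff_of_pos_right (by rw [S_cast_eq]; positivity)]; exact_mod_cast Iff.rfl

/-- `val (a + b) = val a + val b`. [this cell] -/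
theorem val_add (a b : ℕ) : val (a + b) = val a + val b := by
  unfold val; push_cast; ring

/-- `val (n * a) = n * val a` for a plain natural factor. [this cell] -/
theorem val_nat_mul (n a : ℕ) : val (n * a) = (n : ℝ) * val a := by
  unfold val; push_cast; ring

/-- `val S = 1`. [this cell] -/
theorem val_S : val S = 1 := by unfold val; exact div_self (by rw [S_cast_eq]; positivity)

/-- `val 0 = 0`. [this cell] -/
theorem val_zero : val 0 = 0 := by unfold val; simp

/-- `val (max a b) = max (val a) (val b)`. [this cell] -/
theorem val_max (a b : ℕ) : val (max a b) = max (val a) (val b) := by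
  rcases le_total a b with h | h
  · rw [max_eq_right h, max_eq_right (val_mono h)]
  · rw [max_eq_left h, max_eq_left (val_mono h)]

/-- `val (min a b) = min (val a) (val b)`. [this cell] -/
theorem val_min (a b : ℕ) : val (min a b) = min (val a) (val b) := by
  rcases le_total a b with h | h
  · rw [min_eq_left h, min_eq_left (val_mono h)]
  · rw [min_eq_right h, min_eq_right (val_mono h)]

/-! ## Ceiling division -/

/-- `n ≤ d·⌈n/d⌉` with `⌈n/d⌉ = (n + (d−1))/d`. [folklore] -/
theorem le_mul_ceilDiv (n d : ℕ) (hd : 0 < d) : n ≤ d * ((n + (d - 1)) / d) := by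
  have h := Nat.lt_div_mul_add (a := n + (d - 1)) hd
  rw [Nat.mul_comm] at h
  omega

/-! ## The five operations -/

/-- `mulU` rounds the product UP: `val a · val b ≤ val (mulU a b)`. [this cell, TIER2-KERNEL-SPEC §0] -/
theorem mulU_spec (a b : ℕ) : val a * val b ≤ val (mulU a b) := by
  have h := le_mul_ceilDiv (a * b) S (by rw [S_eq_two_pow]; positivity)
  have hS : (0 : ℝ) < (S : ℝ) := by rw [S_cast_eq]; positivity
  unfold val mulU
  rw [div_mul_div_comm, div_le_div_iff₀ (mul_pos hS hS) hS]
  have h' : ((a * b : ℕ) : ℝ) ≤ ((S * ((a * b + (S - 1)) / S) : ℕ) : ℝ) := by exact_mod_cast h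
  push_cast at h' ⊢
  nlinarith

/-- `mulD` rounds the product DOWN: `val (mulD a b) ≤ val a · val b`. [this cell, TIER2-KERNEL-SPEC §0] -/
theorem mulD_spec (a b : ℕ) : val (mulD a b) ≤ val a * val b := by
  have h := Nat.div_mul_le_self (a * b) S
  have hS : (0 : ℝ) < (S : ℝ) := by rw [S_cast_eq]; positivity
  unfold val mulD
  rw [div_mul_div_comm, div_le_div_iff₀ hS (mul_pos hS hS)]
  have h' : (((a * b / S) * S : ℕ) : ℝ) ≤ ((a * b : ℕ) : ℝ) := by exact_mod_cast h
  push_cast at h' ⊢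
  nlinarith

/-- `divU` rounds the quotient UP: `val a / val b ≤ val (divU a b)` (`b > 0`). [this cell, TIER2-KERNEL-SPEC §0] -/
theorem divU_spec (a b : ℕ) (hb : 0 < b) : val a / val b ≤ val (divU a b) := by
  have h := le_mul_ceilDiv (a * S) b hb
  have hS : (0 : ℝ) < (S : ℝ) := by rw [S_cast_eq]; positivity
  have hb' : (0 : ℝ) < b := by exact_mod_cast hb
  unfold val divU
  rw [div_div_div_cancel_right₀ hS.ne', div_le_div_iff₀ hb' hS]
  have h' : ((a * S : ℕ) : ℝ) ≤ ((b * ((a * S + (b - 1)) / b) : ℕ) : ℝ) := by exact_mod_cast h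
  push_cast at h' ⊢
  nlinarith

/-- `divUn` rounds UP: `val a / n ≤ val (divUn a n)` (`n > 0`). [this cell, TIER2-KERNEL-SPEC §0] -/
theorem divUn_spec (a n : ℕ) (hn : 0 < n) : val a / n ≤ val (divUn a n) := by
  have h := le_mul_ceilDiv a n hn
  have hS : (0 : ℝ) < (S : ℝ) := by rw [S_cast_eq]; positivity
  have hn' : (0 : ℝ) < n := by exact_mod_cast hn
  unfold val divUn
  rw [div_div, div_le_div_iff₀ (mul_pos hS hn') hS]
  have h' : ((a : ℕ) : ℝ) ≤ ((n * ((a + (n - 1)) / n) : ℕ) : ℝ) := by exact_mod_cast h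
  push_cast at h' ⊢
  nlinarith

/-- TRANSFER form of `mulU`: `x ≤ val a`, `0 ≤ y ≤ val b` ⇒ `x·y ≤ val (mulU a b)`. [this cell] -/
theorem le_mulU {x y : ℝ} {a b : ℕ} (hy : 0 ≤ y) (ha : x ≤ val a) (hb : y ≤ val b) :
    x * y ≤ val (mulU a b) :=
  (mul_le_mul ha hb hy (val_nonneg a)).trans (mulU_spec a b)

/-- TRANSFER form of `mulD`: `val a ≤ x`, `val b ≤ y` ⇒ `val (mulD a b) ≤ x·y`. [this cell] -/
theorem mulD_le {x y : ℝ} {a b : ℕ} (ha : val a ≤ x) (hb : val b ≤ y) : val (mulD a b) ≤ x * y :=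
  (mulD_spec a b).trans (mul_le_mul ha hb (val_nonneg b) ((val_nonneg a).trans ha))

/-- TRANSFER form of `divUn`. [this cell] -/
theorem le_divUn {x : ℝ} {a n : ℕ} (ha : x ≤ val a) (hn : 0 < n) : x / n ≤ val (divUn a n) :=
  (div_le_div_of_nonneg_right ha (by exact_mod_cast hn.le)).trans (divUn_spec a n hn)

/-- TRANSFER form of `divU`: `x ≤ val a`, `0 < val b ≤ y` ⇒ `x / y ≤ val (divU a b)`. [this cell] -/
theorem le_divU {x y : ℝ} {a b : ℕ} (ha : x ≤ val a) (hb : 0 < b) (hy : val b ≤ y) :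
    x / y ≤ val (divU a b) := by
  have hvb : 0 < val b := by
    have := val_lt_val.2 hb; rwa [val_zero] at this
  exact (div_le_div₀ (val_nonneg a) ha hvb hy).trans (divU_spec a b hb)

/-- `powU` rounds the power UP: `(val x)^n ≤ val (powU x n)`. [this cell, TIER2-KERNEL-SPEC §0] -/
theorem powU_spec (x : ℕ) : ∀ n : ℕ, val x ^ n ≤ val (powU x n)
  | 0 => by simp [powU, val_S]
  | n + 1 => by
    rw [pow_succ, powU]
    exact le_mulU (val_nonneg x) (powU_spec x n) le_rfl

/-- TRANSFER form of `powU`. [this cell] -/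
theorem le_powU {x : ℝ} {a : ℕ} (hx : 0 ≤ x) (ha : x ≤ val a) (n : ℕ) : x ^ n ≤ val (powU a n) :=
  (pow_le_pow_left₀ hx ha n).trans (powU_spec a n)

/-- `absdiff` is exact: `val (absdiff a b) = |val a − val b|`. [this cell] -/
theorem val_absdiff (a b : ℕ) : val (absdiff a b) = |val a - val b| := by
  unfold absdiff
  split_ifs with h
  · rw [abs_of_nonneg (sub_nonneg.2 (val_mono h))]
    unfold val; rw [Nat.cast_sub h]; ring
  · rw [not_le] at h
    rw [abs_of_nonpos (sub_nonpos.2 (val_mono h.le))]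
    unfold val; rw [Nat.cast_sub h.le]; ring

end Summit.RiemannHypothesis.RiemannHypothesis.Theorems.ThetaTier2
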